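import Summits.HubbardSuperconductivity.HubbardSuperconductivity.Theorems.WidthHaldaneBochnerFloor

/-!
# The wide/thin reduction of the Haldane-form law (crux `WidthHaldaneBridge`, line `IdeaSketchK2`)

Support file for crux `WidthHaldaneBridge` (stmt-HubbardSuperconductivity-16311; routes `WidthHaldane`,
`SeamInduction`), card `bochner-majority-split`. It lands the registered stub `stub_wideThinReduction` of
the line `IdeaSketchK2`: the glue that turns

* on WIDE tubes (`c·log L ≤ M`): tube pair order `A·L²·M² ≤ ‖Δψ‖²` together with the `k = 0` majority
  `(1+ε)/2·L·G_ψ(0) ≤ ‖Δψ‖²` (`‖Δψ‖² = Re⟨ψ, Δ†Δ ψ⟩`, `Δ = Σ_a Σ_b P_{e⁻¹(a,b)}` the total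
  `d_{x²-y²}` pair field, `G_ψ = tubeColumnPairCorr`), and
* on THIN tubes (`M < c·log L`): the law verbatim with amplitude `A`,

into `HaldaneLaw U δ Ξ (A·min(1, 2ε/(1+ε))) R M₂ L₁` (`Theorems/WidthHaldaneDefs.lean`). The wide half is
the landed composition `tubeColumnPairCorr_ge_of_majority` (`Theorems/WidthHaldaneBochnerFloor.lean`,
exponent-free floor `(2ε/(1+ε))·A·L·M² ≤ G_ψ(r)` at every `r`); what is added here is real arithmetic:
the Haldane weight `r̂^{-x}`, `r̂ = min(r, L - r) ≥ 1` (from `1 ≤ R ≤ r̂`), `x = Ξ√(ẽ″/ρ̃)/M ≥ 0`, lies in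
`[0, 1]`, and `A·min(1, 2ε/(1+ε))` is below both `A` and `(2ε/(1+ε))·A`.

* `haldaneWeight_nonneg`, `haldaneWeight_le_one` — `0 ≤ r̂^{-x} ≤ 1`;
* `wideFloor_of_majority_expect` — the wide composition with `‖Δψ‖²` in the `expect` form;
* `haldaneLaw_of_wide_thin` / `stub_wideThinReduction` — the reduction.

Kinematics and bookkeeping only (no spectral input). Sources for the objects: D. J. Scalapino, Phys. Rep.
250 (1995) 329, §2 (column pair field); F. D. M. Haldane, PRL 47 (1981) 1840, eqs. (4)–(7) (the form of
the law).
-/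

noncomputable section

namespace Summit.HubbardSuperconductivity.HubbardSuperconductivity.Theorems.WidthHaldane

set_option linter.dupNamespace false -- summit = problem name (single-conjunct summit), D-0017

open scoped BigOperators Classical Matrix ComplexConjugate
open Matrix Literature.MathematicalPhysics.QuantumLattice

/-! ### The Haldane weight `r̂^{-x}` lies in `[0, 1]` -/

/-- `1 ≤ r̂ = min(r, L - r)` as a real number whenever `1 ≤ R ≤ r` and `r + R ≤ L`. [folklore] -/
theorem one_le_cast_min_of_window {L R n : ℕ} (hR : 1 ≤ R) (hr : R ≤ n) (hrL : n + R ≤ L) :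
    (1 : ℝ) ≤ ((min n (L - n) : ℕ) : ℝ) := by
  have h1 : 1 ≤ n := hR.trans hr
  have h2 : 1 ≤ L - n := by omega
  exact_mod_cast le_min h1 h2

/-- The Haldane weight is nonnegative: `0 ≤ r̂^{-x}`. [cite: Haldane1981, eqs. (4)–(7)] -/
theorem haldaneWeight_nonneg (m : ℕ) (x : ℝ) : (0 : ℝ) ≤ ((m : ℕ) : ℝ) ^ (-x) :=
  Real.rpow_nonneg (Nat.cast_nonneg m) _

/-- The Haldane weight is at most one: `r̂^{-Ξ√q/M} ≤ 1` for `r̂ ≥ 1`, `Ξ ≥ 0`.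
[cite: Haldane1981, eqs. (4)–(7)] -/
theorem haldaneWeight_le_one {m : ℕ} (hm : (1 : ℝ) ≤ (m : ℝ)) {Ξ : ℝ} (hΞ : 0 ≤ Ξ) (q : ℝ) (M : ℕ) :
    ((m : ℕ) : ℝ) ^ (-(Ξ * Real.sqrt q / (M : ℝ))) ≤ 1 :=
  Real.rpow_le_one_of_one_le_of_nonpos hm
    (neg_nonpos.mpr (div_nonneg (mul_nonneg hΞ (Real.sqrt_nonneg q)) (Nat.cast_nonneg M)))

/-- The amplitude bookkeeping: for `0 ≤ A' ≤ B`, `0 ≤ L`, and a weight `p ≤ 1`,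
`A'·L·M²·p ≤ B·L·M²`. [folklore] -/
theorem amp_weight_le {A' B L Msq p : ℝ} (hA' : 0 ≤ A') (hAB : A' ≤ B) (hL : 0 ≤ L) (hM : 0 ≤ Msq)
    (hp1 : p ≤ 1) : A' * L * Msq * p ≤ B * L * Msq := by
  have hLM : 0 ≤ L * Msq := mul_nonneg hL hM
  calc A' * L * Msq * p ≤ A' * L * Msq * 1 :=
        mul_le_mul_of_nonneg_left hp1 (mul_nonneg (mul_nonneg hA' hL) hM)
    _ = A' * (L * Msq) := by ring
    _ ≤ B * (L * Msq) := mul_le_mul_of_nonneg_right hAB hLM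
    _ = B * L * Msq := by ring

/-- The amplitude bookkeeping, weighted form: for `0 ≤ A' ≤ B`, `0 ≤ L`, `0 ≤ p`,
`A'·L·M²·p ≤ B·L·M²·p`. [folklore] -/
theorem amp_weight_le_weight {A' B L Msq p : ℝ} (hAB : A' ≤ B) (hL : 0 ≤ L) (hM : 0 ≤ Msq)
    (hp : 0 ≤ p) : A' * L * Msq * p ≤ B * L * Msq * p :=
  mul_le_mul_of_nonneg_right (mul_le_mul_of_nonneg_right (mul_le_mul_of_nonneg_right hAB hL) hM) hp

/-- `A·min(1, 2ε/(1+ε)) ≤ A` for `A ≥ 0`. [folklore] -/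
theorem mul_min_one_le_self {A : ℝ} (hA : 0 ≤ A) (t : ℝ) : A * min 1 t ≤ A := by
  calc A * min 1 t ≤ A * 1 := mul_le_mul_of_nonneg_left (min_le_left 1 t) hA
    _ = A := mul_one A

/-- `A·min(1, t) ≤ t·A` for `A ≥ 0`. [folklore] -/
theorem mul_min_one_le_mul {A : ℝ} (hA : 0 ≤ A) (t : ℝ) : A * min 1 t ≤ t * A := by
  calc A * min 1 t ≤ A * t := mul_le_mul_of_nonneg_left (min_le_right 1 t) hA
    _ = t * A := mul_comm A t

/-- `0 ≤ A·min(1, 2ε/(1+ε))` for `A ≥ 0`, `ε > 0`. [folklore] -/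
theorem mul_min_one_nonneg {A ε : ℝ} (hA : 0 ≤ A) (hε : 0 < ε) : 0 ≤ A * min 1 (2 * ε / (1 + ε)) :=
  mul_nonneg hA (le_min zero_le_one (div_nonneg (by linarith) (by linarith)))

/-! ### The wide composition in the `expect` form -/

section Tube

variable (L M : ℕ) [NeZero L] [NeZero M] (Λ : Type) [LinearOrder Λ] [Fintype Λ]
  (e : Λ ≃ ZMod L × ZMod M)

/-- **Wide-regime composition, `expect` form**: tube pair order `A·L²·M² ≤ Re⟨ψ, Δ†Δ ψ⟩` and the
`k = 0` majority `(1+ε)/2·L·G_ψ(0) ≤ Re⟨ψ, Δ†Δ ψ⟩` (`ε > 0`) give `(2ε/(1+ε))·A·L·M² ≤ G_ψ(r)` at every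
`r` (`tubeColumnPairCorr_ge_of_majority` after the sum rule `Σ_{r'} G_ψ(r') = Re⟨ψ, Δ†Δ ψ⟩`).
[cite: Scalapino1995, §2 eq. (2.4)] -/
theorem wideFloor_of_majority_expect (ψ : Fock (Orb Λ)) {ε A : ℝ} (hε : 0 < ε)
    (hA : A * (L : ℝ) ^ 2 * (M : ℝ) ^ 2 ≤
      (expect ((∑ a : ZMod L, ∑ b : ZMod M, tubeDWavePair L M Λ e (e.symm (a, b)))ᴴ *
        (∑ a : ZMod L, ∑ b : ZMod M, tubeDWavePair L M Λ e (e.symm (a, b)))) ψ).re)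
    (hmaj : (1 + ε) / 2 * ((L : ℝ) * tubeColumnPairCorr L M Λ e ψ 0) ≤
      (expect ((∑ a : ZMod L, ∑ b : ZMod M, tubeDWavePair L M Λ e (e.symm (a, b)))ᴴ *
        (∑ a : ZMod L, ∑ b : ZMod M, tubeDWavePair L M Λ e (e.symm (a, b)))) ψ).re)
    (r : ZMod L) :
    2 * ε / (1 + ε) * A * (L : ℝ) * (M : ℝ) ^ 2 ≤ tubeColumnPairCorr L M Λ e ψ r := by
  rw [PosSemidefTrace.expect_conjTranspose_mul, ← sum_tubeColumnPairCorr_eq] at hA hmaj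
  exact tubeColumnPairCorr_ge_of_majority L M Λ e ψ hε hA hmaj r

/-- **Wide-regime composition with the Haldane weight**: under the hypotheses of
`wideFloor_of_majority_expect`, for `A > 0`, `Ξ ≥ 0` and `1 ≤ R ≤ r`, `r + R ≤ L`,
`A·min(1, 2ε/(1+ε))·L·M²·r̂^{-Ξ√q/M} ≤ G_ψ(r)`. [cite: Haldane1981, eqs. (4)–(7)] -/
theorem wideFloor_weighted (ψ : Fock (Orb Λ)) {ε A Ξ : ℝ} {R : ℕ} (hε : 0 < ε) (hA0 : 0 < A)
    (hΞ : 0 ≤ Ξ) (hR : 1 ≤ R)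
    (hA : A * (L : ℝ) ^ 2 * (M : ℝ) ^ 2 ≤
      (expect ((∑ a : ZMod L, ∑ b : ZMod M, tubeDWavePair L M Λ e (e.symm (a, b)))ᴴ *
        (∑ a : ZMod L, ∑ b : ZMod M, tubeDWavePair L M Λ e (e.symm (a, b)))) ψ).re)
    (hmaj : (1 + ε) / 2 * ((L : ℝ) * tubeColumnPairCorr L M Λ e ψ 0) ≤
      (expect ((∑ a : ZMod L, ∑ b : ZMod M, tubeDWavePair L M Λ e (e.symm (a, b)))ᴴ *
        (∑ a : ZMod L, ∑ b : ZMod M, tubeDWavePair L M Λ e (e.symm (a, b)))) ψ).re)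
    (r : ZMod L) (hr : R ≤ r.val) (hrL : r.val + R ≤ L) (q : ℝ) :
    A * min 1 (2 * ε / (1 + ε)) * (L : ℝ) * (M : ℝ) ^ 2 *
        ((min r.val (L - r.val) : ℕ) : ℝ) ^ (-(Ξ * Real.sqrt q / (M : ℝ))) ≤
      tubeColumnPairCorr L M Λ e ψ r := by
  have key := wideFloor_of_majority_expect L M Λ e ψ hε hA hmaj r
  refine le_trans ?_ key
  have hmin : (1 : ℝ) ≤ ((min r.val (L - r.val) : ℕ) : ℝ) := one_le_cast_min_of_window hR hr hrL
  calc A * min 1 (2 * ε / (1 + ε)) * (L : ℝ) * (M : ℝ) ^ 2 *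
          ((min r.val (L - r.val) : ℕ) : ℝ) ^ (-(Ξ * Real.sqrt q / (M : ℝ)))
        ≤ 2 * ε / (1 + ε) * A * (L : ℝ) * (M : ℝ) ^ 2 :=
          amp_weight_le (mul_min_one_nonneg hA0.le hε) (mul_min_one_le_mul hA0.le _)
            (Nat.cast_nonneg L) (sq_nonneg _) (haldaneWeight_le_one hmin hΞ q M)

/-- **Thin-regime bookkeeping with the Haldane weight**: a floor `A·L·M²·r̂^{-x} ≤ G` with `A ≥ 0`
gives `A·min(1, 2ε/(1+ε))·L·M²·r̂^{-x} ≤ G`. [cite: Haldane1981, eqs. (4)–(7)] -/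
theorem thinFloor_weighted {A ε G : ℝ} {L M m : ℕ} (hA0 : 0 ≤ A) (x : ℝ)
    (h : A * (L : ℝ) * (M : ℝ) ^ 2 * ((m : ℕ) : ℝ) ^ (-x) ≤ G) :
    A * min 1 (2 * ε / (1 + ε)) * (L : ℝ) * (M : ℝ) ^ 2 * ((m : ℕ) : ℝ) ^ (-x) ≤ G :=
  le_trans (amp_weight_le_weight (mul_min_one_le_self hA0 _) (Nat.cast_nonneg L) (sq_nonneg _)
    (haldaneWeight_nonneg m x)) h

end Tube

/-! ### The reduction -/

/-- **THE WIDE/THIN REDUCTION** (card `bochner-majority-split`): tube pair order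
`A·L²·M² ≤ ‖Δψ‖²` with the `k = 0` majority `(1+ε)/2·L·G_ψ(0) ≤ ‖Δψ‖²` on the wide tubes
(`c·log L ≤ M`), and the law verbatim on the thin ones (`M < c·log L`), give `HaldaneLaw` with the
amplitude `A·min(1, 2ε/(1+ε))` (`R ≥ 1` so that `r̂^{-x} ≤ 1`, `x = Ξ√(ẽ″/ρ̃)/M ≥ 0`). Here
`‖Δψ‖² = Re⟨ψ, Δ†Δψ⟩`, `Δ = Σ_a Σ_b P_{e⁻¹(a,b)}`. [cite: Haldane1981, eqs. (4)–(7)] -/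
theorem haldaneLaw_of_wide_thin (U δ c ε Ξ A : ℝ) (R M₂ L₁ : ℕ) (hε : 0 < ε) (hA : 0 < A)
    (hΞ : 0 ≤ Ξ) (hR : 1 ≤ R)
    (hW : ∀ (L M : ℕ) [NeZero L] [NeZero M], Even L → Even M → M₂ ≤ M → M ≤ L → L₁ ≤ L →
      c * Real.log (L : ℝ) ≤ (M : ℝ) →
        ∀ (Λ : Type) [LinearOrder Λ] [Fintype Λ] (e : Λ ≃ ZMod L × ZMod M) (ψ : Fock (Orb Λ)),
          star ψ ⬝ᵥ ψ = 1 → IsGroundStateInSector (tubeH0 L M Λ e U) (tubeFilling L M δ) 0 ψ →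
            A * (L : ℝ) ^ 2 * (M : ℝ) ^ 2 ≤
                (expect ((∑ a : ZMod L, ∑ b : ZMod M, tubeDWavePair L M Λ e (e.symm (a, b)))ᴴ *
                  (∑ a : ZMod L, ∑ b : ZMod M, tubeDWavePair L M Λ e (e.symm (a, b)))) ψ).re ∧
              (1 + ε) / 2 * ((L : ℝ) * tubeColumnPairCorr L M Λ e ψ 0) ≤
                (expect ((∑ a : ZMod L, ∑ b : ZMod M, tubeDWavePair L M Λ e (e.symm (a, b)))ᴴ *
                  (∑ a : ZMod L, ∑ b : ZMod M, tubeDWavePair L M Λ e (e.symm (a, b)))) ψ).re)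
    (hT : ∀ (L M : ℕ) [NeZero L] [NeZero M], Even L → Even M → M₂ ≤ M → M ≤ L → L₁ ≤ L →
      (M : ℝ) < c * Real.log (L : ℝ) →
        ∀ (Λ : Type) [LinearOrder Λ] [Fintype Λ] (e : Λ ≃ ZMod L × ZMod M) (ψ : Fock (Orb Λ)),
          star ψ ⬝ᵥ ψ = 1 → IsGroundStateInSector (tubeH0 L M Λ e U) (tubeFilling L M δ) 0 ψ →
            ∀ r : ZMod L, R ≤ r.val → r.val + R ≤ L →
              A * (L : ℝ) * (M : ℝ) ^ 2 * ((min r.val (L - r.val) : ℕ) : ℝ) ^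
                  (-(Ξ * Real.sqrt (tubePairCompressibility L M Λ e U δ / tubeStiffness L M Λ e U δ) / (M : ℝ))) ≤
                tubeColumnPairCorr L M Λ e ψ r) :
    HaldaneLaw U δ Ξ (A * min 1 (2 * ε / (1 + ε))) R M₂ L₁ := by
  intro L M _ _ hLe hMe hM hML hL Λ _ _ e ψ hψ hGS r hr hrL
  by_cases hw : c * Real.log (L : ℝ) ≤ (M : ℝ)
  · obtain ⟨h1, h2⟩ := hW L M hLe hMe hM hML hL hw Λ e ψ hψ hGS
    exact wideFloor_weighted L M Λ e ψ hε hA hΞ hR h1 h2 r hr hrL _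
  · exact thinFloor_weighted hA.le _
      (hT L M hLe hMe hM hML hL (lt_of_not_ge hw) Λ e ψ hψ hGS r hr hrL)

/-- STUB `stub_wideThinReduction` of line `IdeaSketchK2` of crux `WidthHaldaneBridge`
(stmt-HubbardSuperconductivity-16311), registered form: the wide/thin reduction
`haldaneLaw_of_wide_thin`. [cite: Haldane1981, eqs. (4)–(7)] -/
theorem stub_wideThinReduction :
    ∀ (U δ c ε Ξ A : ℝ) (R M₂ L₁ : ℕ), 0 < ε → 0 < A → 0 ≤ Ξ → 1 ≤ R →
      (∀ (L M : ℕ) [NeZero L] [NeZero M], Even L → Even M → M₂ ≤ M → M ≤ L → L₁ ≤ L →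
        c * Real.log (L : ℝ) ≤ (M : ℝ) →
          ∀ (Λ : Type) [LinearOrder Λ] [Fintype Λ] (e : Λ ≃ ZMod L × ZMod M) (ψ : Fock (Orb Λ)),
            star ψ ⬝ᵥ ψ = 1 → IsGroundStateInSector (tubeH0 L M Λ e U) (tubeFilling L M δ) 0 ψ →
              A * (L : ℝ) ^ 2 * (M : ℝ) ^ 2 ≤
                  (expect ((∑ a : ZMod L, ∑ b : ZMod M, tubeDWavePair L M Λ e (e.symm (a, b)))ᴴ *
                    (∑ a : ZMod L, ∑ b : ZMod M, tubeDWavePair L M Λ e (e.symm (a, b)))) ψ).re ∧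
                (1 + ε) / 2 * ((L : ℝ) * tubeColumnPairCorr L M Λ e ψ 0) ≤
                  (expect ((∑ a : ZMod L, ∑ b : ZMod M, tubeDWavePair L M Λ e (e.symm (a, b)))ᴴ *
                    (∑ a : ZMod L, ∑ b : ZMod M, tubeDWavePair L M Λ e (e.symm (a, b)))) ψ).re) →
      (∀ (L M : ℕ) [NeZero L] [NeZero M], Even L → Even M → M₂ ≤ M → M ≤ L → L₁ ≤ L →
        (M : ℝ) < c * Real.log (L : ℝ) →
          ∀ (Λ : Type) [LinearOrder Λ] [Fintype Λ] (e : Λ ≃ ZMod L × ZMod M) (ψ : Fock (Orb Λ)),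
            star ψ ⬝ᵥ ψ = 1 → IsGroundStateInSector (tubeH0 L M Λ e U) (tubeFilling L M δ) 0 ψ →
              ∀ r : ZMod L, R ≤ r.val → r.val + R ≤ L →
                A * (L : ℝ) * (M : ℝ) ^ 2 * ((min r.val (L - r.val) : ℕ) : ℝ) ^
                    (-(Ξ * Real.sqrt (tubePairCompressibility L M Λ e U δ / tubeStiffness L M Λ e U δ) / (M : ℝ))) ≤
                  tubeColumnPairCorr L M Λ e ψ r) →
      HaldaneLaw U δ Ξ (A * min 1 (2 * ε / (1 + ε))) R M₂ L₁ :=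
  haldaneLaw_of_wide_thin

end Summit.HubbardSuperconductivity.HubbardSuperconductivity.Theorems.WidthHaldane

end
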